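import Literature.IUT.HodgeTheaters.InitialThetaDataCurveModel
import HarnessLib

/-!
# [IUTchI] Def. 3.1: laws of the named model `InitialThetaData.nfCurveModel` — Thm-1.9 inputs, `k̄_NF = k̄`,
# truncation of points, and the structure morphisms `X_F → C_F`, `C_K → C_F`, `X_K → X_F`, `X_K → C_K`

S. Mochizuki, *Inter-universal Teichmüller theory I*, §3, Definition 3.1 (b) "`C_F := X_F // {±1}`", (d)
"`C_K := C_F ×_F K`", "`X_K := X_F ×_F K`" (kurims final manuscript, May 2020, pp. 61–62)
[claim: Mochizuki2012, status: disputed]; [AbsTopIII] Def. 1.7, Thm. 1.9 pp. 35–38, Rmk. 2.8.3 p. 64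
[MochizukiAbsTopIII2015].  abc-iut cell, GAP B item GB-07 (`GAP-SIZING-B.md` row D7), PROOF companion of
`InitialThetaDataCurveModel.lean` (the model `D.nfCurveModelOfPoints N` / `D.nfCurveModel`; curves
`C_F, X_F, C_K, X_K`; `Π`'s = open subgroups of the interface `Π_{C_F}`):

* `isThm19Input_nfCurveModelOfPoints` / `isThm19Input_nfCurveModel` — all four curves are inputs of
  [AbsTopIII] Thm. 1.9 (strictly Belyi type FILLED BY PRINT, Rmk. 2.8.3 + Def. 3.1 (d); sub-`p`-adic base REAL,
  the tree's `IsSubpadic.of_isNF`); `kbarNF_nfCurveModelOfPoints_eq_top` (`k̄_NF = k̄` over a number field);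
* `truncatePoints`, **`thm_1_9_nfCurveModel_of_points : Thm_1_9 (D.nfCurveModelOfPoints N) → Thm_1_9 D.nfCurveModel`**
  — the fields-only binder at `nfCurveModel` (clause (a) reads "`nfPointDecomp = ∅`") is IMPLIED by the binder at
  any points-enriched model: nothing is smuggled by not recording points;
* the five inclusions `Π_{X_F} ↪ Π_{C_F}`, `Π_{C_K} ↪ Π_{C_F}`, `Π_{X_K} ↪ Π_{X_F}`, `Π_{X_K} ↪ Π_{C_K}`,
  `Π_{X_K} ↪ Π_{C_F}` as morphisms `D.nfCurveExt _ ⟶ D.nfCurveExt _` (`homXFCF`, `homCKCF`, `homXKXF`, `homXKCK`,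
  `homXKCF`; the two triangles commute), each PROVED `IsOpenInjective` ([AbsTopIII] Thm. 1.9 p. 38 "arbitrary
  open injective homomorphisms of extensions of profinite groups" — so `NFPortionAlgorithm.comap` applies under
  `Thm_1_9`), and `C_K → C_F`, `X_K → X_F` PROVED `IsBaseChange` ("homomorphisms … arising from a base-change of
  the base field": bijective on `Δ`, since `Δ_C ⊆ Π_{C_K}` — so `comapBase` applies); generic adapter
  `ofOpenSubgroupLEHom X h : X.ofOpenSubgroup U ⟶ X.ofOpenSubgroup V` for open `U ≤ V ≤ Π` (complement to the
  tree's A1 `ofOpenSubgroupι`), open injective.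

Pure profinite-group / field plumbing over the interface; nothing of the disputed series is asserted; no side
is taken on [IUTchIII] Cor. 3.12; no `instance`, no notation.
-/

noncomputable section

namespace Literature.IUT.HodgeTheaters

open CategoryTheory Topology
open Literature.AnabelianGeometry.AbsoluteAnabelian
open Literature.AnabelianGeometry.AbsoluteAnabelian.AbsTopIII

universe u v

namespace InitialThetaData

/-! ### Inclusions of open subgroups as homomorphisms of extensions -/

/-- For open subgroups `U ≤ V` of `Π`, the inclusion `E.ofOpenSubgroup U ⟶ E.ofOpenSubgroup V` of the
tree's adapter-A1 extensions (`U ↪ V` on `Π`, `aug(U) ↪ aug(V)` on `G`). [cite: MochizukiAbsTopIII2015, Thm 1.9 p.38] -/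
def ofOpenSubgroupLEHom (X : FundamentalExtension.{v}) {U V : OpenSubgroup X.arith}
    (h : (U : Subgroup X.arith) ≤ V) : X.ofOpenSubgroup U ⟶ X.ofOpenSubgroup V where
  arith := { Subgroup.inclusion h with
    continuous_toFun := Continuous.subtype_mk continuous_subtype_val _ }
  gal := { Subgroup.inclusion (Subgroup.map_mono h : (X.augImage U).toSubgroup ≤ (X.augImage V).toSubgroup) with
    continuous_toFun := Continuous.subtype_mk continuous_subtype_val _ }
  comm := fun _ => rfl

/-- The `Π`-component of `ofOpenSubgroupLEHom` is the inclusion. [cite: MochizukiAbsTopIII2015, Thm 1.9 p.38] -/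
@[simp] theorem ofOpenSubgroupLEHom_arith_apply_coe (X : FundamentalExtension.{v})
    {U V : OpenSubgroup X.arith} (h : (U : Subgroup X.arith) ≤ V) (x : (X.ofOpenSubgroup U).arith) :
    ((ofOpenSubgroupLEHom X h).arith x).1 = x.1 := rfl

/-- The `G`-component of `ofOpenSubgroupLEHom` is the inclusion. [cite: MochizukiAbsTopIII2015, Thm 1.9 p.38] -/
@[simp] theorem ofOpenSubgroupLEHom_gal_apply_coe (X : FundamentalExtension.{v})
    {U V : OpenSubgroup X.arith} (h : (U : Subgroup X.arith) ≤ V) (g : (X.ofOpenSubgroup U).gal) :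
    ((ofOpenSubgroupLEHom X h).gal g).1 = g.1 := rfl

/-- `ofOpenSubgroupLEHom` followed by the inclusion of `V` is the inclusion of `U`.
[cite: MochizukiAbsTopIII2015, Thm 1.9 p.38] -/
theorem ofOpenSubgroupLEHom_comp_ι (X : FundamentalExtension.{v}) {U V : OpenSubgroup X.arith}
    (h : (U : Subgroup X.arith) ≤ V) :
    ofOpenSubgroupLEHom X h ≫ X.ofOpenSubgroupι V = X.ofOpenSubgroupι U :=
  FundamentalExtension.Hom.ext (ContinuousMonoidHom.ext fun _ => rfl) (ContinuousMonoidHom.ext fun _ => rfl)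

/-- `ofOpenSubgroupLEHom` is an OPEN INJECTIVE homomorphism of extensions ("arbitrary open injective
homomorphisms of extensions of profinite groups", [AbsTopIII] Thm. 1.9 p. 38): `U` is open in `V` and
`aug(U)` is open in `aug(V)`. [cite: MochizukiAbsTopIII2015, Thm 1.9 p.38] -/
theorem isOpenInjective_ofOpenSubgroupLEHom (X : FundamentalExtension.{v}) {U V : OpenSubgroup X.arith}
    (h : (U : Subgroup X.arith) ≤ V) : (ofOpenSubgroupLEHom X h).IsOpenInjective where
  arith_injective := fun _ _ e => Subgroup.inclusion_injective h e
  isOpen_range_arith := by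
    have hr : Set.range (ofOpenSubgroupLEHom X h).arith = Subtype.val ⁻¹' ((U : Subgroup X.arith) : Set X.arith) := by
      ext y
      constructor
      · rintro ⟨x, rfl⟩
        exact x.2
      · intro hy
        exact ⟨⟨y.1, hy⟩, rfl⟩
    rw [hr]
    exact U.isOpen.preimage continuous_subtype_val
  gal_injective := fun _ _ e =>
    Subgroup.inclusion_injective
      (Subgroup.map_mono h : (X.augImage U).toSubgroup ≤ (X.augImage V).toSubgroup) e
  isOpen_range_gal := by
    have hr : Set.range (ofOpenSubgroupLEHom X h).gal =
        Subtype.val ⁻¹' ((X.augImage U).toSubgroup : Set X.gal) := by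
      ext y
      constructor
      · rintro ⟨x, rfl⟩
        exact x.2
      · intro hy
        exact ⟨⟨y.1, hy⟩, rfl⟩
    rw [hr]
    exact (X.isOpen_augImage U).preimage continuous_subtype_val

section Laws

variable {F K Fbar : Type u} [Field F] [NumberField F] [Field K] [NumberField K] [Algebra F K]
  [Field Fbar] [Algebra F Fbar] [Algebra K Fbar] {E : WeierstrassCurve F} [E.IsElliptic] {l : ℕ}
  {Pb : BadPlacePredicates K} (D : InitialThetaData F K Fbar E l Pb)

/-! ### The four curves are inputs of [AbsTopIII] Thm. 1.9; `k̄_NF = k̄`; truncation of points -/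

variable (N : D.NFPointData)

/-- The base field of every curve of the model is a number field (`F` or `K`). [claim: Mochizuki2012, status: disputed] -/
theorem isNF_base (U : (D.nfCurveModelOfPoints N).Curve) :
    Literature.AnabelianGeometry.AbsoluteAnabelian.IsNF ((D.nfCurveModelOfPoints N).base U) := by
  obtain ⟨_ | _ | _ | _⟩ := U
  · exact ⟨(inferInstance : NumberField F)⟩
  · exact ⟨(inferInstance : NumberField F)⟩
  · exact ⟨(inferInstance : NumberField K)⟩
  · exact ⟨(inferInstance : NumberField K)⟩

/-- The base field of every curve of the model is sub-`p`-adic (number fields are: the tree's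
`IsSubpadic.of_isNF`). [claim: Mochizuki2012, status: disputed] -/
theorem isSubpadic_base (U : (D.nfCurveModelOfPoints N).Curve) :
    IsSubpadic ((D.nfCurveModelOfPoints N).base U) :=
  IsSubpadic.of_isNF (D.isNF_base N U)

/-- **Every curve of the model is an input of [AbsTopIII] Thm. 1.9** ("a hyperbolic orbicurve of strictly
Belyi type over a sub-`p`-adic field"): `IsThm19Input` = strictly Belyi type (filled by print, Rmk. 2.8.3)
∧ sub-`p`-adic base (REAL).  So the binder `Thm_1_9 (D.nfCurveModelOfPoints N)` speaks about all four curves.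
[claim: Mochizuki2012, status: disputed] -/
theorem isThm19Input_nfCurveModelOfPoints (U : (D.nfCurveModelOfPoints N).Curve) :
    (D.nfCurveModelOfPoints N).IsThm19Input U :=
  ⟨trivial, D.isSubpadic_base N U⟩

/-- Every curve of `nfCurveModel` is an input of [AbsTopIII] Thm. 1.9. [claim: Mochizuki2012, status: disputed] -/
theorem isThm19Input_nfCurveModel (U : D.nfCurveModel.Curve) : D.nfCurveModel.IsThm19Input U :=
  D.isThm19Input_nfCurveModelOfPoints _ U

/-- **`k̄_NF = k̄` for every curve of the model**: the algebraic closure of `ℚ` in `k^alg` is everything,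
`k = F, K` being number fields — which is why `IsNFCurve`, `IsNFRational`, `IsNFConstant` are identically
`True` and `NFFunctionField` is the function field over `F̄` (Def. 1.7, Thm. 1.9 (d) of [AbsTopIII] with
`k̄_NF = k̄`). [claim: Mochizuki2012, status: disputed] -/
theorem kbarNF_nfCurveModelOfPoints_eq_top (U : (D.nfCurveModelOfPoints N).Curve) :
    (D.nfCurveModelOfPoints N).kbarNF U = ⊤ := by
  have key : ∀ (k : Type u) [Field k] [NumberField k],
      algebraicClosure ℚ (AlgebraicClosure k) = ⊤ := by
    intro k _ _
    haveI : Algebra.IsAlgebraic ℚ (AlgebraicClosure k) := Algebra.IsAlgebraic.trans ℚ k (AlgebraicClosure k)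
    exact le_antisymm le_top fun x _ => (mem_algebraicClosure_iff).2 (Algebra.IsAlgebraic.isAlgebraic x)
  obtain ⟨_ | _ | _ | _⟩ := U
  · exact key F
  · exact key F
  · exact key K
  · exact key K

/-- `k̄_NF = k̄` for every curve of `nfCurveModel`. [claim: Mochizuki2012, status: disputed] -/
theorem kbarNF_nfCurveModel_eq_top (U : D.nfCurveModel.Curve) : D.nfCurveModel.kbarNF U = ⊤ :=
  D.kbarNF_nfCurveModelOfPoints_eq_top _ U

/-- Truncation of the point output of a Thm-1.9 algorithm record: same fields, same functoriality, empty
`nfPointDecomp` (the laws of `NFPortionAlgorithm` only involve the fields).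
[cite: MochizukiAbsTopIII2015, Thm 1.9 (a) p.37] -/
def truncatePoints (A : NFPortionAlgorithm.{u}) : NFPortionAlgorithm.{u} where
  obj X := { A.obj X with nfPointDecomp := ∅ }
  map e := ⟨(A.map e).constEquiv, (A.map e).funEquiv, (A.map e).comm⟩
  map_id := A.map_id
  map_comp := A.map_comp
  comap := A.comap
  comap_map := A.comap_map
  comapBase := A.comapBase

/-- **The fields-only binder is implied by any points-enriched binder** ("nothing smuggled"): for every
closed-point datum `N`, `Thm_1_9 (D.nfCurveModelOfPoints N) → Thm_1_9 D.nfCurveModel` — truncate the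
witnessing algorithm's point output to `∅`; the field comparisons (d)(e) are literally the same.
[claim: Mochizuki2012, status: disputed] -/
theorem thm_1_9_nfCurveModel_of_points (h : Thm_1_9 (D.nfCurveModelOfPoints N)) : Thm_1_9 D.nfCurveModel := by
  obtain ⟨A, hA⟩ := h
  refine ⟨truncatePoints A, fun X hX => ⟨?_, (hA X hX).2.1, (hA X hX).2.2⟩⟩
  ext H
  simp only [truncatePoints, Set.mem_empty_iff_false, Set.mem_setOf_eq, false_iff]
  rintro ⟨x, -, -, -⟩
  exact x.elim


/-! ### The structure morphisms `X_F → C_F`, `C_K → C_F`, `X_K → X_F`, `X_K → C_K`, `X_K → C_F` -/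

/-- `Δ_C ⊆ Π_{C_K}` (`Π_{C_K} = augGF⁻¹(G_K)` contains the kernel of `augGF`). [claim: Mochizuki2012, status: disputed] -/
theorem DeltaC_le_PiCK : D.DeltaC ≤ D.PiCK := by
  intro x hx
  change x ∈ D.geom.embK.range
  rw [D.geom.embK_range, Subgroup.mem_comap]
  have h1 : D.augGF x = 1 := (D.augGF_eq_one_iff x).2 hx
  change D.augGF x ∈ galoisSubgroupOf F K Fbar
  rw [h1]
  exact one_mem _

/-- `Π_{X_K} ≤ Π_{X_F}`. [claim: Mochizuki2012, status: disputed] -/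
theorem PiXK_le_PiX : (D.openPiXK : Subgroup D.PiC) ≤ D.openPiX := inf_le_left

/-- `Π_{X_K} ≤ Π_{C_K}`. [claim: Mochizuki2012, status: disputed] -/
theorem PiXK_le_PiCK : (D.openPiXK : Subgroup D.PiC) ≤ D.openPiCK := inf_le_right

/-- `X_F → C_F` ("`C_F := X_F // {±1}`", the double cover): the inclusion `Π_{X_F} ↪ Π_{C_F}` as a
homomorphism of extensions. [claim: Mochizuki2012, status: disputed] -/
def homXFCF : D.nfCurveExt .XF ⟶ D.nfCurveExt .CF :=
  D.geom.extF.ofOpenSubgroupι D.openPiX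

/-- `C_K → C_F` ("`C_K := C_F ×_F K`"): `Π_{C_K} ↪ Π_{C_F}`. [claim: Mochizuki2012, status: disputed] -/
def homCKCF : D.nfCurveExt .CK ⟶ D.nfCurveExt .CF :=
  D.geom.extF.ofOpenSubgroupι D.openPiCK

/-- `X_K → C_F`: `Π_{X_K} ↪ Π_{C_F}`. [claim: Mochizuki2012, status: disputed] -/
def homXKCF : D.nfCurveExt .XK ⟶ D.nfCurveExt .CF :=
  D.geom.extF.ofOpenSubgroupι D.openPiXK

/-- `X_K → X_F` ("`X_K := X_F ×_F K`"): `Π_{X_K} ↪ Π_{X_F}`. [claim: Mochizuki2012, status: disputed] -/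
def homXKXF : D.nfCurveExt .XK ⟶ D.nfCurveExt .XF :=
  ofOpenSubgroupLEHom D.geom.extF D.PiXK_le_PiX

/-- `X_K → C_K` (the double cover over `K`): `Π_{X_K} ↪ Π_{C_K}`. [claim: Mochizuki2012, status: disputed] -/
def homXKCK : D.nfCurveExt .XK ⟶ D.nfCurveExt .CK :=
  ofOpenSubgroupLEHom D.geom.extF D.PiXK_le_PiCK

/-- The square `X_K → X_F → C_F` = `X_K → C_F` commutes. [claim: Mochizuki2012, status: disputed] -/
theorem homXKXF_comp_homXFCF : D.homXKXF ≫ D.homXFCF = D.homXKCF :=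
  ofOpenSubgroupLEHom_comp_ι _ _

/-- The square `X_K → C_K → C_F` = `X_K → C_F` commutes. [claim: Mochizuki2012, status: disputed] -/
theorem homXKCK_comp_homCKCF : D.homXKCK ≫ D.homCKCF = D.homXKCF :=
  ofOpenSubgroupLEHom_comp_ι _ _

/-- `X_F → C_F` is an open injective homomorphism of extensions (finite étale double cover).
[claim: Mochizuki2012, status: disputed] -/
theorem isOpenInjective_homXFCF : D.homXFCF.IsOpenInjective :=
  D.geom.extF.isOpenInjective_ofOpenSubgroupι _

/-- `C_K → C_F` is an open injective homomorphism of extensions. [claim: Mochizuki2012, status: disputed] -/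
theorem isOpenInjective_homCKCF : D.homCKCF.IsOpenInjective :=
  D.geom.extF.isOpenInjective_ofOpenSubgroupι _

/-- `X_K → C_F` is an open injective homomorphism of extensions. [claim: Mochizuki2012, status: disputed] -/
theorem isOpenInjective_homXKCF : D.homXKCF.IsOpenInjective :=
  D.geom.extF.isOpenInjective_ofOpenSubgroupι _

/-- `X_K → X_F` is an open injective homomorphism of extensions. [claim: Mochizuki2012, status: disputed] -/
theorem isOpenInjective_homXKXF : D.homXKXF.IsOpenInjective :=
  isOpenInjective_ofOpenSubgroupLEHom _ _

/-- `X_K → C_K` is an open injective homomorphism of extensions. [claim: Mochizuki2012, status: disputed] -/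
theorem isOpenInjective_homXKCK : D.homXKCK.IsOpenInjective :=
  isOpenInjective_ofOpenSubgroupLEHom _ _

/-- **`C_K → C_F` arises from the base change `F ⊆ K`**: `Π_{C_K} → Π_{C_F}` is a bijection on the
geometric fundamental groups (`Δ_{C_K} = Δ_C`, since `Δ_C ⊆ Π_{C_K}`) — the functoriality class
"homomorphisms … arising from a base-change of the base field" of [AbsTopIII] Thm. 1.9 p. 38.
[claim: Mochizuki2012, status: disputed] -/
theorem isBaseChange_homCKCF : D.homCKCF.IsBaseChange := by
  refine ⟨⟨fun x hx => (D.geom.extF.mem_geom_ofOpenSubgroup_iff D.openPiCK x).1 hx, ?_, ?_⟩⟩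
  · exact fun x _ y _ h => Subtype.ext h
  · intro y hy
    exact ⟨⟨y, D.DeltaC_le_PiCK hy⟩, (D.geom.extF.mem_geom_ofOpenSubgroup_iff D.openPiCK _).2 hy, rfl⟩

/-- **`X_K → X_F` arises from the base change `F ⊆ K`**: `Δ_{X_K} = Δ_{X_F}` (`= Π_{X_F} ∩ Δ_C`).
[claim: Mochizuki2012, status: disputed] -/
theorem isBaseChange_homXKXF : D.homXKXF.IsBaseChange := by
  refine ⟨⟨fun x hx => ?_, ?_, ?_⟩⟩
  · exact (D.geom.extF.mem_geom_ofOpenSubgroup_iff D.openPiX _).2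
      ((D.geom.extF.mem_geom_ofOpenSubgroup_iff D.openPiXK x).1 hx)
  · exact fun x _ y _ h => Subgroup.inclusion_injective D.PiXK_le_PiX h
  · intro y hy
    have hy' : y.1 ∈ D.geom.extF.geom := (D.geom.extF.mem_geom_ofOpenSubgroup_iff D.openPiX y).1 hy
    exact ⟨⟨y.1, y.2, D.DeltaC_le_PiCK hy'⟩,
      (D.geom.extF.mem_geom_ofOpenSubgroup_iff D.openPiXK _).2 hy', rfl⟩

end Laws

end InitialThetaData
end Literature.IUT.HodgeTheaters
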